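import Summits.HodgeConjecture.CorCM.GaloisOddPrimeShapesQuaternionBottom
import Summits.HodgeConjecture.CorCM.GaloisQuaternionSixteenCyclicThirtyOneSets
import HarnessLib

/-!
# `p = 31` from the bottom `Q₁₆ × C_{31}`: shapes Q× (`n ≥ 4`) and QK (`n ≥ 5`) are BAD, GOOD Galois CM fields of degree `2ⁿ·31`
# (`n ≥ 5`) have shape C(r) or Dic, and `Gal ≅ Q_{16k} × C_{31}` is BAD for every `k ≥ 1`

COR-CM (cell `pub-hodgecm2`), binder seat b04 (gen 42), count-neutral own lane «Galois-CM-type classification».  KERNEL ONLY: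
theorems; no definition, no named fact, no `sorry`.  `HC_CM` is neither used nor claimed.

Gen 41's `p = 31` column (`CorCM/GaloisOddPrimeColumnThirtyOne`) rests on the Gauss-alphabet word on `Q₆₄ × C_{31}` (`t = 4`): Q× BAD for
`n ≥ 6`, QK and the structure theorem for `n ≥ 7`.  The general-fibre two-sheet format of gen 42 (`CorCM/GaloisQuaternionCyclicTwoSheetSets`)
and its sextic-letter certificate `exists_simple_degenerate_of_quaternionSixteen_cyclic31_subgroup` (`CorCM/GaloisQuaternionSixteenCyclicThirtyOneSets`:
`Q₁₆ × C_{31} ↪ Gal` through `c` with `C_{31}` normal ⟹ BAD) lower the bottom to `t = 2` — the true bottom of the `p = 31` tower, since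
`Q₈ × C_{31}` is GOOD (`ord₃₁ 2 = 5` odd).  Through the parametric column `CorCM/GaloisOddPrimeShapesQuaternionBottom`:

* `bottom_certificate_thirtyone_sixteen` (`t = 2`), `exists_simple_degenerate_of_shape_quaternion_thirtyone_sixteen` (Q× for `n ≥ 4`,
  QK for `n ≥ 5`), `structure_of_forall_isNondegenerate_of_thirtytwo_dvd_thirtyone_sixteen` (`n ≥ 5`: GOOD ⟹ C(r) or Dic),
  `exists_simple_degenerate_of_mulEquiv_quaternion_prod_cyclic_thirtyone_sixteen` (`Gal ≅ Q_{16k} × C_{31}`, every `k ≥ 1`).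

NOT here: the Hodge payload / dichotomy for `n = 5, 6` — gen 38's residue condition `2ⁿ⁻¹ ∤ 31 + 1 = 32` for the C(r) shapes fails there
(the C(r) shapes with `ord r = 2` of degrees `2⁵·31`, `2⁶·31` are not covered by the C(r) theorem); for `n ≥ 7` see gen 41's column.

## References

* [Shimura1998] G. Shimura, *Abelian Varieties with Complex Multiplication and Modular Functions*, §6.2 Thm. 3, §8.2 Prop. 26, §32.10.
* [Gordon1999HodgeAVSurvey] B. B. Gordon, *A survey of the Hodge conjecture for abelian varieties*, Thm. 6.4, §9.3.
* [Dodson1984] B. Dodson, *The structure of Galois groups of CM-fields*, Trans. AMS 283 (1984), §3.1.1, §4.1, §5.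
-/

noncomputable section

open CategoryTheory CategoryTheory.Limits NumberField
open scoped BigOperators

namespace Summit.HodgeConjecture.CorCM.GaloisModels

open Literature.NumberTheory.ComplexMultiplication Literature.AlgebraicGeometry.HodgeTheory
open Literature.AlgebraicGeometry.Motives (AbelianVariety CMType)
open Literature.AlgebraicGeometry.ComplexMultiplication (IsCMTypeRealisation)
open Literature.AlgebraicGeometry.Pohlmann1968 Summit.HodgeConjecture.CorCM.GaloisRank
open Literature.Barriers.HodgeConjecture (divisorClassesSpan)
open QuaternionGroup

variable {K : Type} [Field K] [NumberField K] [IsCMField K]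

/-- **The bottom certificate `Q₁₆ × C_{31} ↪ Gal(K/ℚ)` through `c` with `C_{31}` normal ⟹ BAD**, in the parametric form (`t = 2`).
[cite: Shimura1998, §6.2 Thm. 3 and §8.2 Prop. 26] [cite: Gordon1999HodgeAVSurvey, Thm. 6.4 and §9.3] -/
theorem bottom_certificate_thirtyone_sixteen [IsGalois ℚ K] :
    ∀ A X v : K ≃ₐ[ℚ] K, orderOf A = 2 ^ (2 + 1) → X * X = A ^ 2 ^ 2 → X * A * X⁻¹ = A⁻¹ →
      A ^ 2 ^ 2 = (IsCMField.complexConj K).restrictScalars ℚ → orderOf v = 31 → A * v = v * A → X * v = v * X →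
      (Subgroup.zpowers v).Normal →
      ∃ (Φ : CMType K) (φ₀ : K →+* ℂ) (A : AbelianVariety ℂ) (ι : 𝓞 K →+* End A)
        (θ : K →+* Module.End ℂ (complexBetti A.X 1)),
        IsPrimitive (ℂ ≃+* ℂ) Φ.1 φ₀ ∧ ¬ IsNondegenerate Φ ∧ IsCMTypeRealisation Φ A ι θ ∧ A.IsSimple ∧
        A.dim = Module.finrank ℚ K / 2 ∧
        ∃ n p : ℕ, ∃ x : complexBetti (⨁ fun _ : Fin n => A).X (2 * p), IsRationalClass x ∧
          IsOfHodgeType (⨁ fun _ : Fin n => A).dim (⨁ fun _ : Fin n => A).X (2 * p) p p x ∧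
          x ∉ divisorClassesSpan (⨁ fun _ : Fin n => A).X (⨁ fun _ : Fin n => A).dim p := by
  intro A X v hA hX hXA hc hv hAv hXv hnorm
  norm_num at hA hX hc
  exact exists_simple_degenerate_of_quaternionSixteen_cyclic31_subgroup hA hX hXA hc hv hAv hXv hnorm

/-- **SHAPES Q× (`n ≥ 4`) AND QK (`n ≥ 5`) ARE BAD FOR `p = 31`** (subgroup `⟨a^{2ⁿ⁻⁴}, x⟩ × ⟨u⟩ ≅ Q₁₆ × C_{31}` through `c`).
[cite: Shimura1998, §6.2 Thm. 3 and §8.2 Prop. 26] [cite: Gordon1999HodgeAVSurvey, Thm. 6.4 and §9.3] -/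
theorem exists_simple_degenerate_of_shape_quaternion_thirtyone_sixteen [IsGalois ℚ K] {n : ℕ} (hn : 4 ≤ n) {u a x : K ≃ₐ[ℚ] K}
    (hu : orderOf u = 31) (hnorm : (Subgroup.zpowers u).Normal) (ha : orderOf a = 2 ^ (n - 1)) (hxa : x * a = a⁻¹ * x)
    (hxx : x * x = a ^ 2 ^ (n - 2)) (hc : a ^ 2 ^ (n - 2) = (IsCMField.complexConj K).restrictScalars ℚ)
    (hxu : x * u * x⁻¹ = u) (hau : a * u * a⁻¹ = u ∨ (a * u * a⁻¹ = u⁻¹ ∧ 5 ≤ n)) :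
    ∃ (Φ : CMType K) (φ₀ : K →+* ℂ) (A : AbelianVariety ℂ) (ι : 𝓞 K →+* End A)
      (θ : K →+* Module.End ℂ (complexBetti A.X 1)),
      IsPrimitive (ℂ ≃+* ℂ) Φ.1 φ₀ ∧ ¬ IsNondegenerate Φ ∧ IsCMTypeRealisation Φ A ι θ ∧ A.IsSimple ∧
      A.dim = Module.finrank ℚ K / 2 ∧
      ∃ n p : ℕ, ∃ x : complexBetti (⨁ fun _ : Fin n => A).X (2 * p), IsRationalClass x ∧
        IsOfHodgeType (⨁ fun _ : Fin n => A).dim (⨁ fun _ : Fin n => A).X (2 * p) p p x ∧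
        x ∉ divisorClassesSpan (⨁ fun _ : Fin n => A).X (⨁ fun _ : Fin n => A).dim p :=
  exists_simple_degenerate_of_shape_quaternion_of_bottom bottom_certificate_thirtyone_sixteen (by omega) hu hnorm ha hxa hxx hc hxu
    (hau.imp_right fun h => ⟨h.1, by omega⟩)

/-- **GOOD Galois CM fields of degree `2ⁿ·31`, `n ≥ 5`: shape C(r) or Dic.** [cite: Shimura1998, §8.2 Prop. 26 and §32.10]
[cite: Dodson1984, §3.1.1, §4.1 and §5] -/
theorem structure_of_forall_isNondegenerate_of_thirtytwo_dvd_thirtyone_sixteen [IsGalois ℚ K] {n : ℕ}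
    (hdeg : Module.finrank ℚ K = 2 ^ n * 31) (hn : 5 ≤ n)
    (hgood : ∀ (Φ : CMType K) (φ : K →+* ℂ), IsPrimitive (ℂ ≃+* ℂ) Φ.1 φ → IsNondegenerate Φ) [Fact (Nat.Prime 2)] :
    (∀ σ : K ≃ₐ[ℚ] K, σ * σ = 1 → σ ≠ 1 → σ = (IsCMField.complexConj K).restrictScalars ℚ) ∧
      ∀ S : Sylow 2 (K ≃ₐ[ℚ] K), Nat.card (S : Subgroup (K ≃ₐ[ℚ] K)) = 2 ^ n ∧
        ((∃ u x : K ≃ₐ[ℚ] K, orderOf u = 31 ∧ (Subgroup.zpowers u).Normal ∧ orderOf x = 2 ^ n ∧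
            Subgroup.zpowers x = (S : Subgroup (K ≃ₐ[ℚ] K)) ∧ (∀ g : K ≃ₐ[ℚ] K, ∃ j i : ℕ, g = u ^ j * x ^ i) ∧
            ∃ r : ℕ, x * u * x⁻¹ = u ^ r) ∨
         (∃ u a x : K ≃ₐ[ℚ] K, orderOf u = 31 ∧ (Subgroup.zpowers u).Normal ∧ orderOf a = 2 ^ (n - 1) ∧
            a ∈ (S : Subgroup (K ≃ₐ[ℚ] K)) ∧ x ∈ (S : Subgroup (K ≃ₐ[ℚ] K)) ∧ x ∉ Subgroup.zpowers a ∧ x * a = a⁻¹ * x ∧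
            x * x = a ^ 2 ^ (n - 2) ∧ (∀ g : K ≃ₐ[ℚ] K, ∃ j i : ℕ, g = u ^ j * a ^ i ∨ g = u ^ j * (x * a ^ i)) ∧
            a * u * a⁻¹ = u ∧ x * u * x⁻¹ = u⁻¹)) :=
  structure_of_forall_isNondegenerate_of_thirtytwo_dvd_of_bottom (t := 2) (by norm_num) (by norm_num) hdeg (by omega) (by omega)
    bottom_certificate_thirtyone_sixteen hgood

/-- **`Gal(K/ℚ) ≅ Q_{16k} × C_{31}` IS BAD** for every `k ≥ 1` (`Q_{16k} = QuaternionGroup (4k)`; `k = 1`: `Q₁₆ × C_{31}` itself).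
[cite: Shimura1998, §6.2 Thm. 3 and §8.2 Prop. 26] [cite: Gordon1999HodgeAVSurvey, Thm. 6.4 and §9.3] -/
theorem exists_simple_degenerate_of_mulEquiv_quaternion_prod_cyclic_thirtyone_sixteen [IsGalois ℚ K] {k : ℕ} [NeZero k]
    (e : (K ≃ₐ[ℚ] K) ≃* QuaternionGroup (4 * k) × Multiplicative (ZMod 31)) :
    ∃ (Φ : CMType K) (φ₀ : K →+* ℂ) (A : AbelianVariety ℂ) (ι : 𝓞 K →+* End A)
      (θ : K →+* Module.End ℂ (complexBetti A.X 1)),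
      IsPrimitive (ℂ ≃+* ℂ) Φ.1 φ₀ ∧ ¬ IsNondegenerate Φ ∧ IsCMTypeRealisation Φ A ι θ ∧ A.IsSimple ∧
      A.dim = Module.finrank ℚ K / 2 ∧
      ∃ n p : ℕ, ∃ x : complexBetti (⨁ fun _ : Fin n => A).X (2 * p), IsRationalClass x ∧
        IsOfHodgeType (⨁ fun _ : Fin n => A).dim (⨁ fun _ : Fin n => A).X (2 * p) p p x ∧
        x ∉ divisorClassesSpan (⨁ fun _ : Fin n => A).X (⨁ fun _ : Fin n => A).dim p :=
  exists_simple_degenerate_of_mulEquiv_quaternion_prod_cyclic_of_bottom (t := 2) (by decide) bottom_certificate_thirtyone_sixteen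
    (by rwa [show (2 : ℕ) ^ 2 = 4 by norm_num])

end Summit.HodgeConjecture.CorCM.GaloisModels
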